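import Summits.PneNP.PneNP.Theorems.ReslinSizeFromWidthPCDegreeGOPSeparation
import Mathlib.Analysis.SpecificLimits.Normed
import HarnessLib

/-!
# PneNP / ReslinSizeFromWidth — a CEILING for size-from-rank laws: no law exponential in the rank holds for bounded-width CNFs

Helper file (negative knowledge) for crux `ResLinSizeFromWidth` (stmt-PneNP-18932).  The crux asks
for a size lower bound from a rank lower bound that is LINEAR IN THE NUMBER OF VARIABLES
(`rank ≥ N/m`).  The GOP contrast cell (`exists_GOP_easy_hard`,
`ReslinSizeFromWidthPCDegreeGOPSeparation.lean`) shows why a weaker hypothesis cannot suffice: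
Galesi–Lauria's `GOP(G_n)` over the in-tree expanders is a 12-CNF on `Θ(n²)` variables all of whose
Res(⊕) refutations have rank `≥ ⌊n/72⌋/4`, yet it has dag-like Res(⊕) refutations with `≤ 12n³`
lines.  Hence (`no_exponential_size_from_rank`): there is NO constant `c > 0` such that every
12-CNF all of whose Res(⊕) refutations have rank `≥ d` requires Res(⊕) refutations of size
`≥ 2^{c·d}` — the tree-like law `2^(d - t - 1)` (`ResLinSW.pow_le_length_of_treeLike`) has no
dag-like analogue, and on this family (rank `Θ(√N)`) size is polynomial.  (For resolution WIDTH
this is Bonet–Galesi's optimality of the size–width trade-off; for PC degree it is Galesi–Lauria's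
Thm 2; here it is stated for Res(⊕) rank with semantic weakening, kernel-checked.)

Honest framing: a folklore-level ceiling assembled from landed results; it does NOT bear on the
crux as stated (rank linear in `N`), only on exponential-in-rank variants.

References: M. L. Bonet, N. Galesi, Comput. Complexity 10 (2001); N. Galesi, M. Lauria, ACM ToCL
12(1) (2010), Thm 2; M. Garlík, L. Kołodziejczyk, ACM ToCL 19(4) (2018), §8.
-/

noncomputable section

namespace Summit.PneNP.PneNP.Theorems

-- `Summit.PneNP.PneNP` repeats a path component by design (summit = sub-problem); silence the linter.
set_option linter.dupNamespace false

namespace ResLinPC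

open Filter Literature.Computability.Complexity Literature.Computability.MetaComplexity
open scoped Topology

/-- Exponentials beat cubes: for `c > 0`, eventually `12 n³ < 2^{c (n/288 - 2)}`. [bookkeeping] -/
private theorem eventually_cube_lt_two_pow {c : ℝ} (hc : 0 < c) :
    ∀ᶠ n : ℕ in atTop, (12 : ℝ) * (n : ℝ) ^ 3 < (2 : ℝ) ^ (c * ((n : ℝ) / 288 - 2)) := by
  -- `r = 2^{-c/288}` has `|r| < 1`, so `n³ r^n → 0`
  set r : ℝ := (2 : ℝ) ^ (-(c / 288)) with hr
  have hrpos : 0 < r := Real.rpow_pos_of_pos (by norm_num) _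
  have hr1 : r < 1 := Real.rpow_lt_one_of_one_lt_of_neg (by norm_num) (by linarith)
  have habs : |r| < 1 := by rw [abs_of_pos hrpos]; exact hr1
  have hlim := tendsto_pow_const_mul_const_pow_of_abs_lt_one 3 habs
  have hK : (0 : ℝ) < (2 : ℝ) ^ (-(2 * c)) / 12 := by positivity
  have hev := (hlim.eventually (gt_mem_nhds hK))
  filter_upwards [hev] with n hn
  -- `n³ r^n < 2^{-2c}/12`  ⇒  `12 n³ < 2^{-2c} r^{-n} = 2^{c(n/288 - 2)}`
  have hrn : r ^ n = (2 : ℝ) ^ (-(c / 288) * n) := by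
    rw [hr, ← Real.rpow_natCast, ← Real.rpow_mul (by norm_num)]
  have hsplit : (2 : ℝ) ^ (c * ((n : ℝ) / 288 - 2)) = (2 : ℝ) ^ (-(2 * c)) / r ^ n := by
    rw [hrn, eq_div_iff (Real.rpow_pos_of_pos (by norm_num) _).ne',
      ← Real.rpow_add (by norm_num : (0 : ℝ) < 2)]
    congr 1; ring
  rw [hsplit, lt_div_iff₀ (pow_pos hrpos n)]
  nlinarith [pow_pos hrpos n]

/-- **No size-from-rank law exponential in the rank (bounded width, Res(⊕) with semantic
weakening).**  There is no `c > 0` such that every 12-CNF all of whose Res(⊕) refutations contain a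
line of rank `≥ d` has only Res(⊕) refutations with at least `2^{c·d}` lines: Galesi–Lauria's
`GOP(G_n)` over the in-tree expanders has rank `≥ ⌊n/72⌋/4` everywhere but a refutation with
`≤ 12n³` lines. [Bonet–Galesi 2001 (shape, for resolution width); Galesi–Lauria 2010, Thm 2 (for PC
degree); assembled from `exists_GOP_easy_hard`] -/
theorem no_exponential_size_from_rank :
    ¬ ∃ c : ℝ, 0 < c ∧ ∀ (φ : CNF ℕ) (d : ℕ), φ.IsWidthLE 12 →
        (∀ π : List ResLinLine, IsResLinRefutation φ π → d ≤ resLinWidth π) →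
        ∀ π : List ResLinLine, IsResLinRefutation φ π → (2 : ℝ) ^ (c * d) ≤ π.length := by
  rintro ⟨c, hc, hlaw⟩
  obtain ⟨n, hn⟩ := ((eventually_cube_lt_two_pow hc).and (eventually_ge_atTop 3744)).exists
  obtain ⟨hlt, hn⟩ := hn
  obtain ⟨G, inst, hdeg, -, ⟨π, hπ, hlen⟩, -, hrank⟩ := exists_GOP_easy_hard.{0} n hn
  -- the rank bound `d = ⌊n/72⌋/4 ≥ 13`
  set d : ℕ := n / 72 / 4 with hd
  have h13 : 13 ≤ d := by rw [hd]; omega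
  have hdle : (d : ℝ) ≤ ((n / 72 : ℕ) : ℝ) / 4 := by
    rw [hd, le_div_iff₀ (by norm_num : (0 : ℝ) < 4)]
    exact_mod_cast Nat.div_mul_le_self (n / 72) 4
  have hwidth : (GOP.glGOP G).IsWidthLE 12 := GOP.isWidthLE_glGOP G (by norm_num) hdeg
  have hall : ∀ π' : List ResLinLine, IsResLinRefutation (GOP.glGOP G) π' → d ≤ resLinWidth π' :=
    fun π' hπ' => (hrank d h13 hdle π' hπ').1
  have hsize := hlaw (GOP.glGOP G) d hwidth hall π hπ
  -- `2^{c d} ≥ 2^{c (n/288 - 2)} > 12 n³ ≥ |π|`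
  have hdge : (n : ℝ) / 288 - 2 ≤ d := by
    have h1 : ((n / 72 : ℕ) : ℝ) > (n : ℝ) / 72 - 1 := by
      have := Nat.lt_div_mul_add (a := n) (b := 72) (by norm_num)
      have h' : (n : ℝ) < ((n / 72 : ℕ) : ℝ) * 72 + 72 := by exact_mod_cast this
      linarith
    have h2 : (d : ℝ) > ((n / 72 : ℕ) : ℝ) / 4 - 1 := by
      have := Nat.lt_div_mul_add (a := n / 72) (b := 4) (by norm_num)
      have h' : ((n / 72 : ℕ) : ℝ) < (d : ℝ) * 4 + 4 := by rw [hd]; exact_mod_cast this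
      linarith
    linarith
  have hmono : (2 : ℝ) ^ (c * ((n : ℝ) / 288 - 2)) ≤ (2 : ℝ) ^ (c * d) :=
    Real.rpow_le_rpow_of_exponent_le (by norm_num) (mul_le_mul_of_nonneg_left hdge hc.le)
  have hlen' : (π.length : ℝ) ≤ 12 * (n : ℝ) ^ 3 := by exact_mod_cast hlen
  linarith

end ResLinPC

end Summit.PneNP.PneNP.Theorems
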